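import Literature.NumberTheory.Automorphic.QuadraticHeckeCharacterCMInfinityType
import Literature.NumberTheory.Automorphic.IdeleClassCharacterHecke
import HarnessLib

/-!
# Splitting / design Hecke characters of a CM field in the `HeckeCharacter` language

Topic `NumberTheory/Automorphic`; namespace `Literature.NumberTheory.Automorphic`. **No named facts, no
`sorry`**, imports = tree.

For a CM field `L` with maximal totally real subfield `L⁺` and quadratic character `ε = ε_{L/L⁺}`
(`quadraticHeckeCharCM L : HeckeCharacter L⁺`), an integer `m` and exponents `e : (w ∣ ∞) → ℤ` with
`e_w ≡ m (mod 2)`: there is a UNITARY Hecke character `χ` of `L` of unitary archimedean type `(e, 0)`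
(`χ((x,1)) = ∏_w (ι_w x_w/|ι_w x_w|)^{e_w}`, `HeckeCharacter.HasUnitaryArchType`) whose restriction to the
ideles of `L⁺` is `ε^m` (`exists_heckeCharacter_of_isCMField`); in particular (`m` odd) `χ|_{𝕀_{L⁺}} = ε`
(`exists_heckeCharacter_restrict_eq_quadraticHeckeCharCM`) and (`e` even) `χ|_{𝕀_{L⁺}} = 1`
(`exists_heckeCharacter_restrict_eq_one`).  These are the tree theorems
`exists_ideleClassChar_of_isCMField[_odd|_even]` (`C_L →ₜ* S¹` language, Weil BNT VII §3) transported
along the dictionary `IdeleClassGroup.toHeckeCharacter` / `hasUnitaryArchType_toHeckeCharacter_iff`.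

## References

* A. Weil, *Basic Number Theory* (1967), Ch. VII §3. [WeilBNT1967]
* S. Patrikis, *Variations on a theorem of Tate*, Mem. AMS 258 (2019), §2.1. [Patrikis2019]
-/

noncomputable section

open NumberField

namespace Literature.NumberTheory.Automorphic

open GaloisRepresentations (HeckeCharacter ideleGroup)

variable (L : Type) [Field L] [NumberField L] [IsCMField L]

local notation3 "L⁺" => maximalRealSubfield L

/-- **Unitary Hecke characters of a CM field with prescribed unitary archimedean type and restriction
`ε^m` to `𝕀_{L⁺}`** (`e_w ≡ m mod 2`). [cite: WeilBNT1967, Ch. VII §3] -/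
theorem exists_heckeCharacter_of_isCMField (m : ℤ) (e : InfinitePlace L → ℤ)
    (he : ∀ w, e w ≡ m [ZMOD 2]) :
    ∃ χ : HeckeCharacter L, χ.IsUnitary ∧ χ.HasUnitaryArchType e 0 ∧
      ∀ x : ideleGroup L⁺, ((χ (AdeleRing.ideleBaseChange L⁺ L x) : ℂˣ) : ℂ) =
        ((quadraticHeckeCharCM L x : ℂˣ) : ℂ) ^ m := by
  obtain ⟨ψ, hψ, hres⟩ := exists_ideleClassChar_of_isCMField L m e he
  refine ⟨IdeleClassGroup.toHeckeCharacter L ψ, IdeleClassGroup.isUnitary_toHeckeCharacter L ψ,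
    (IdeleClassGroup.hasUnitaryArchType_toHeckeCharacter_iff L ψ e).mpr hψ, fun x => ?_⟩
  rw [IdeleClassGroup.coe_toHeckeCharacter_apply, ← classBaseChange_mk, hres, Circle.coe_zpow,
    coe_quadraticClassCharCM_mk]

/-- **Splitting characters**: for `m` odd and `e_w` odd at every place there is a unitary Hecke character
`χ` of `L` of unitary archimedean type `(e, 0)` with `χ|_{𝕀_{L⁺}} = ε_{L/L⁺}`.
[cite: WeilBNT1967, Ch. VII §3] -/
theorem exists_heckeCharacter_restrict_eq_quadraticHeckeCharCM (e : InfinitePlace L → ℤ)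
    (he : ∀ w, Odd (e w)) :
    ∃ χ : HeckeCharacter L, χ.IsUnitary ∧ χ.HasUnitaryArchType e 0 ∧
      ∀ x : ideleGroup L⁺, χ (AdeleRing.ideleBaseChange L⁺ L x) = quadraticHeckeCharCM L x := by
  obtain ⟨ψ, hψ, hres⟩ := exists_ideleClassChar_of_isCMField_odd L odd_one e fun w => by
    obtain ⟨k, hk⟩ := he w
    exact (Int.modEq_iff_dvd).2 ⟨-k, by rw [hk]; ring⟩
  refine ⟨IdeleClassGroup.toHeckeCharacter L ψ, IdeleClassGroup.isUnitary_toHeckeCharacter L ψ,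
    (IdeleClassGroup.hasUnitaryArchType_toHeckeCharacter_iff L ψ e).mpr hψ, fun x => Units.ext ?_⟩
  rw [IdeleClassGroup.coe_toHeckeCharacter_apply, ← classBaseChange_mk, hres, coe_quadraticClassCharCM_mk]

/-- **Characters trivial on `𝕀_{L⁺}`** with prescribed even unitary archimedean type.
[cite: WeilBNT1967, Ch. VII §3] -/
theorem exists_heckeCharacter_restrict_eq_one (e : InfinitePlace L → ℤ) (he : ∀ w, Even (e w)) :
    ∃ χ : HeckeCharacter L, χ.IsUnitary ∧ χ.HasUnitaryArchType e 0 ∧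
      ∀ x : ideleGroup L⁺, χ (AdeleRing.ideleBaseChange L⁺ L x) = 1 := by
  obtain ⟨ψ, hψ, hres⟩ := exists_ideleClassChar_of_isCMField_even L e he
  refine ⟨IdeleClassGroup.toHeckeCharacter L ψ, IdeleClassGroup.isUnitary_toHeckeCharacter L ψ,
    (IdeleClassGroup.hasUnitaryArchType_toHeckeCharacter_iff L ψ e).mpr hψ, fun x => Units.ext ?_⟩
  rw [IdeleClassGroup.coe_toHeckeCharacter_apply, ← classBaseChange_mk, hres, Units.val_one, Circle.coe_one]

end Literature.NumberTheory.Automorphic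

end
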